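import Summits.AtomisticToContinuum.Crystallization.Theorems.PalmUnimodularRigidityShellsToBarlowChartTransportOpsDefs

/-!
# Line `develop-the-model-growth-descent` (crux `ShellsToBarlowChart`, stmt-AtomisticToContinuum-9227): pattern facts, part 11

Decidable facts (the link of a site: STAR image, LINK rows, lower-apex formulas, enumerations) about the two integer kissing patterns `fcc3Int`, `hcpInt` (labels at squared
norm `18`) used by the frame transports of `stub_transportSystem`: hexagons, even/odd caps,
their filters, apexes, distance tables, lower caps and the letters read on them.  Every fact was
first verified by brute force (work/sim/facts.py of the lead's folder) and is proved here by
`decide` (split into small files so that each elaborates quickly).  All `[folklore]`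
(finite checks on the cuboctahedron / anticuboctahedron, HalesDSP2012 §1.3).
-/

namespace Summit.AtomisticToContinuum.Crystallization.Theorems.PalmUnimodularRigidityShellsToBarlowChart

open Literature.Geometry.DiscreteGeometry Literature.MathematicalPhysics.StatisticalMechanics

/-- LINK (hcp_p), row of the offset `(0, -1, 1)` (label `(a - b)`): touching among the twelve link labels is `linkAdj`. [folklore] -/
theorem linkRow_hcp_p_4 : ∀ y ∈ linkOffsets (-1) 1, ∀ a ∈ hcpInt, ∀ b ∈ hcpInt, ∀ c ∈ hcpInt, sqNormInt (a - b) = 18 → hexLabels a b ⊆ hcpInt → c ∉ hexLabels a b → c - a ∈ hcpInt → c - b ∈ hcpInt → (sqNormInt (((if (((0 : ℤ), ((-1) : ℤ), (1 : ℤ))).1 = 1 then c else if (((0 : ℤ), ((-1) : ℤ), (1 : ℤ))).1 = -1 then (c - ((c 0 + c 1 + c 2) / 6 * 4) • (1 : Fin 3 → ℤ)) else 0) - (((0 : ℤ), ((-1) : ℤ), (1 : ℤ))).2.1 • a - (((0 : ℤ), ((-1) : ℤ), (1 : ℤ))).2.2 • b) - ((if y.1 = 1 then c else if y.1 = -1 then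 (c - ((c 0 + c 1 + c 2) / 6 * 4) • (1 : Fin 3 → ℤ)) else 0) - y.2.1 • a - y.2.2 • b)) = 18 ↔ linkAdj (-1) 1 ((0 : ℤ), ((-1) : ℤ), (1 : ℤ)) y) := by
  decide

/-- LINK (hcp_p), row of the offset `(0, 0, -1)` (label `(b)`): touching among the twelve link labels is `linkAdj`. [folklore] -/
theorem linkRow_hcp_p_5 : ∀ y ∈ linkOffsets (-1) 1, ∀ a ∈ hcpInt, ∀ b ∈ hcpInt, ∀ c ∈ hcpInt, sqNormInt (a - b) = 18 → hexLabels a b ⊆ hcpInt → c ∉ hexLabels a b → c - a ∈ hcpInt → c - b ∈ hcpInt → (sqNormInt (((if (((0 : ℤ), (0 : ℤ), ((-1) : ℤ))).1 = 1 then c else if (((0 : ℤ), (0 : ℤ), ((-1) : ℤ))).1 = -1 then (c - ((c 0 + c 1 + c 2) / 6 * 4) • (1 : Fin 3 → ℤ)) else 0) - (((0 : ℤ), (0 : ℤ), ((-1) : ℤ))).2.1 • a - (((0 : ℤ), (0 : ℤ), ((-1) : ℤ))).2.2 • b) - ((if y.1 = 1 then c else if y.1 = -1 then (c - ((c 0 +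 c 1 + c 2) / 6 * 4) • (1 : Fin 3 → ℤ)) else 0) - y.2.1 • a - y.2.2 • b)) = 18 ↔ linkAdj (-1) 1 ((0 : ℤ), (0 : ℤ), ((-1) : ℤ)) y) := by
  decide

/-- LINK (hcp_p), row of the offset `(0, 0, 1)` (label `(-b)`): touching among the twelve link labels is `linkAdj`. [folklore] -/
theorem linkRow_hcp_p_6 : ∀ y ∈ linkOffsets (-1) 1, ∀ a ∈ hcpInt, ∀ b ∈ hcpInt, ∀ c ∈ hcpInt, sqNormInt (a - b) = 18 → hexLabels a b ⊆ hcpInt → c ∉ hexLabels a b → c - a ∈ hcpInt → c - b ∈ hcpInt → (sqNormInt (((if (((0 : ℤ), (0 : ℤ), (1 : ℤ))).1 = 1 then c else if (((0 : ℤ), (0 : ℤ), (1 : ℤ))).1 = -1 then (c - ((c 0 + c 1 + c 2) / 6 * 4) • (1 : Fin 3 → ℤ)) else 0) - (((0 : ℤ), (0 : ℤ), (1 : ℤ))).2.1 • a - (((0 : ℤ), (0 : ℤ), (1 : ℤ))).2.2 • b) - ((if y.1 = 1 then c else if y.1 = -1 then (c - ((c 0 + c 1 + c 2) / 6 * 4)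 • (1 : Fin 3 → ℤ)) else 0) - y.2.1 • a - y.2.2 • b)) = 18 ↔ linkAdj (-1) 1 ((0 : ℤ), (0 : ℤ), (1 : ℤ)) y) := by
  decide

/-- LINK (hcp_p), row of the offset `(0, 1, -1)` (label `(-a + b)`): touching among the twelve link labels is `linkAdj`. [folklore] -/
theorem linkRow_hcp_p_7 : ∀ y ∈ linkOffsets (-1) 1, ∀ a ∈ hcpInt, ∀ b ∈ hcpInt, ∀ c ∈ hcpInt, sqNormInt (a - b) = 18 → hexLabels a b ⊆ hcpInt → c ∉ hexLabels a b → c - a ∈ hcpInt → c - b ∈ hcpInt → (sqNormInt (((if (((0 : ℤ), (1 : ℤ), ((-1) : ℤ))).1 = 1 then c else if (((0 : ℤ), (1 : ℤ), ((-1) : ℤ))).1 = -1 then (c - ((c 0 + c 1 + c 2) / 6 * 4) • (1 : Fin 3 → ℤ)) else 0) - (((0 : ℤ), (1 : ℤ), ((-1) : ℤ))).2.1 • a - (((0 : ℤ), (1 : ℤ), ((-1) : ℤ))).2.2 • b) - ((if y.1 = 1 then c else if y.1 = -1 then (c - ((c 0 + c 1 + c 2) / 6 * 4) • (1 : Fin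 3 → ℤ)) else 0) - y.2.1 • a - y.2.2 • b)) = 18 ↔ linkAdj (-1) 1 ((0 : ℤ), (1 : ℤ), ((-1) : ℤ)) y) := by
  decide

/-- LINK (hcp_p), row of the offset `(0, 1, 0)` (label `(-a)`): touching among the twelve link labels is `linkAdj`. [folklore] -/
theorem linkRow_hcp_p_8 : ∀ y ∈ linkOffsets (-1) 1, ∀ a ∈ hcpInt, ∀ b ∈ hcpInt, ∀ c ∈ hcpInt, sqNormInt (a - b) = 18 → hexLabels a b ⊆ hcpInt → c ∉ hexLabels a b → c - a ∈ hcpInt → c - b ∈ hcpInt → (sqNormInt (((if (((0 : ℤ), (1 : ℤ), (0 : ℤ))).1 = 1 then c else if (((0 : ℤ), (1 : ℤ), (0 : ℤ))).1 = -1 then (c - ((c 0 + c 1 + c 2) / 6 * 4) • (1 : Fin 3 → ℤ)) else 0) - (((0 : ℤ), (1 : ℤ), (0 : ℤ))).2.1 • a - (((0 : ℤ), (1 : ℤ), (0 : ℤ))).2.2 • b) - ((if y.1 = 1 then c else if y.1 = -1 then (c - ((c 0 + c 1 + c 2) / 6 * 4) • (1 : Fin 3 → ℤ)) else 0) - y.2.1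 • a - y.2.2 • b)) = 18 ↔ linkAdj (-1) 1 ((0 : ℤ), (1 : ℤ), (0 : ℤ)) y) := by
  decide

/-- LINK (hcp_p), row of the offset `(1, 0, 0)` (label `(c)`): touching among the twelve link labels is `linkAdj`. [folklore] -/
theorem linkRow_hcp_p_9 : ∀ y ∈ linkOffsets (-1) 1, ∀ a ∈ hcpInt, ∀ b ∈ hcpInt, ∀ c ∈ hcpInt, sqNormInt (a - b) = 18 → hexLabels a b ⊆ hcpInt → c ∉ hexLabels a b → c - a ∈ hcpInt → c - b ∈ hcpInt → (sqNormInt (((if (((1 : ℤ), (0 : ℤ), (0 : ℤ))).1 = 1 then c else if (((1 : ℤ), (0 : ℤ), (0 : ℤ))).1 = -1 then (c - ((c 0 + c 1 + c 2) / 6 * 4) • (1 : Fin 3 → ℤ)) else 0) - (((1 : ℤ), (0 : ℤ), (0 : ℤ))).2.1 • a - (((1 : ℤ), (0 : ℤ), (0 : ℤ))).2.2 • b) - ((if y.1 = 1 then c else if y.1 = -1 then (c - ((c 0 + c 1 + c 2) / 6 * 4) • (1 : Fin 3 → ℤ)) else 0) - y.2.1 • a - y.2.2 • b)) = 18 ↔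 linkAdj (-1) 1 ((1 : ℤ), (0 : ℤ), (0 : ℤ)) y) := by
  decide

/-- LINK (hcp_p), row of the offset `(1, 0, 1)` (label `(c - b)`): touching among the twelve link labels is `linkAdj`. [folklore] -/
theorem linkRow_hcp_p_10 : ∀ y ∈ linkOffsets (-1) 1, ∀ a ∈ hcpInt, ∀ b ∈ hcpInt, ∀ c ∈ hcpInt, sqNormInt (a - b) = 18 → hexLabels a b ⊆ hcpInt → c ∉ hexLabels a b → c - a ∈ hcpInt → c - b ∈ hcpInt → (sqNormInt (((if (((1 : ℤ), (0 : ℤ), (1 : ℤ))).1 = 1 then c else if (((1 : ℤ), (0 : ℤ), (1 : ℤ))).1 = -1 then (c - ((c 0 + c 1 + c 2) / 6 * 4) • (1 : Fin 3 → ℤ)) else 0) - (((1 : ℤ), (0 : ℤ), (1 : ℤ))).2.1 • a - (((1 : ℤ), (0 : ℤ), (1 : ℤ))).2.2 • b) - ((if y.1 = 1 then c else if y.1 = -1 then (c - ((c 0 + c 1 + c 2) / 6 * 4) • (1 : Fin 3 → ℤ)) else 0) - y.2.1 • a - y.2.2 • b)) = 18 ↔ linkAdj (-1) 1 ((1 :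 ℤ), (0 : ℤ), (1 : ℤ)) y) := by
  decide

/-- LINK (hcp_p), row of the offset `(1, 1, 0)` (label `(c - a)`): touching among the twelve link labels is `linkAdj`. [folklore] -/
theorem linkRow_hcp_p_11 : ∀ y ∈ linkOffsets (-1) 1, ∀ a ∈ hcpInt, ∀ b ∈ hcpInt, ∀ c ∈ hcpInt, sqNormInt (a - b) = 18 → hexLabels a b ⊆ hcpInt → c ∉ hexLabels a b → c - a ∈ hcpInt → c - b ∈ hcpInt → (sqNormInt (((if (((1 : ℤ), (1 : ℤ), (0 : ℤ))).1 = 1 then c else if (((1 : ℤ), (1 : ℤ), (0 : ℤ))).1 = -1 then (c - ((c 0 + c 1 + c 2) / 6 * 4) • (1 : Fin 3 → ℤ)) else 0) - (((1 : ℤ), (1 : ℤ), (0 : ℤ))).2.1 • a - (((1 : ℤ), (1 : ℤ), (0 : ℤ))).2.2 • b) - ((if y.1 = 1 then c else if y.1 = -1 then (c - ((c 0 + c 1 + c 2) / 6 * 4) • (1 : Fin 3 → ℤ)) else 0) - y.2.1 • a - y.2.2 • b)) = 18 ↔ linkAdj (-1) 1 ((1 : ℤ), (1 : ℤ), (0 :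 ℤ)) y) := by
  decide

end Summit.AtomisticToContinuum.Crystallization.Theorems.PalmUnimodularRigidityShellsToBarlowChart
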